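import Mathlib

/-!
# Crux `PercNearOneGluing.NoHeavyLowerTail` (stmt-CriticalPhenomena-4575), line `bhk-superadditivity-thinning` —
# the STAR LEMMA (first-hit charging in the deadness order), law-level form

Lead `prover-line-stmt-CriticalPhenomena-4575-c3-0`, 2026-08-16; lands with `--supports stmt-CriticalPhenomena-4575`.

## Content

The law-level inequality behind lead c1's "FH-kn for star-attached observers"
(`Cruxes/NoHeavyLowerTail/Lines/bhk-superadditivity-thinning-star-theorem.md`), with a NEW, inductive proof
(lead c3) replacing c1's pair-expansion certificate.  Setting: `k` "units" `0, …, k-1` carrying entrance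
coins of weights `q j ∈ [0,1]` (independent, integrated out explicitly below), and a finitely supported
nonnegative law (`s`, `p`) of a random finite set `L ω` of ALIVE units (in the percolation application:
the relay points joined to the hub in the graph with the observer deleted).  Priority is given to LARGER
indices (the deadest unit is the last one): the hit weight of unit `j` is `slW q k j = q j ∏_{j<i<k}(1-q i)`.
With `slPi q L k = ∏_{i<k}(1 - q i·1{i ∈ L})` (= the probability that no open coin lands in `L`),
`slAll q k = ∏_{i<k}(1-q i)` (no open coin at all), the BAD mass (some coin open, no open coin alive) is
`slBad = Σ_ω p ω (slPi q (L ω) k - slAll q k)` and the unreliability of unit `j` (dead and not rescued: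
rescue = own coin open and some other open coin alive) is
`slR … k j = Σ_ω p ω 1{j ∉ L ω}(1 - q j (1 - slPi q (L ω) k))`.

**Star Lemma** (`starLemma`, binder form `starLemma'`).  If the deadness `slD … j = Σ_ω p ω 1{j ∉ L ω}` is monotone
(non-decreasing) in `j` on `0, …, k-1`, then `slBad ≤ Σ_{j<k} slW q k j · slR … k j` — the bad mass is
at most the hit-weighted sum of the unreliabilities ("bad ≤ E[r_hit; hit exists]").  The ONLY property of
the law used is the ordering of the non-membership marginals.  Proof: induction on `k`, peeling the deadest
unit; the step reduces to the exchange inequality `P(j ∉ L, k ∈ L) ≤ P(k ∉ L, j ∈ L)` (from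
`slD j ≤ slD k`) and the telescoping bound `Σ_{j<k, j∈L} slW q k j ≤ 1 - slPi q L k`
(`starLemma_sum_filter_slW_le`).

Why it matters for the crux (recorded, not formalised here): conditionally on the observer's relay-free
pocket `C* = W` the bad event `{o ↔ A} ∩ {o ↮ b}` has exactly this structure (entrances = independent
coins, `L` = relay points alive in `G − W`), so the lemma gives the sharpest known per-pocket bound
`bad_W ≤ Σ_a π_a(W)·P(a ↮ b | C* = W)` (tight in lead c3's 7-vertex witness, Lines/…-c3.md); the W-level
selection inequality that would turn it into hub-Conjecture 1 is FALSE (same note), so the lemma is a tool,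
not a route.  [cite: KozmaNitzan2024, §3.2 Thm 4 (the deadness order `P_{G∖0}(a ↔ b)`) and §5.5 Question 9]
-/

namespace Summit.CriticalPhenomena.PercolationContinuityZ3.Theorems

open Finset

open scoped BigOperators

variable {Ω : Type*}

/-! ### The six quantities (written out in full in every statement; no definitions, no notation)

* `(Finset.prod (Finset.range k) (fun i => if i ∈ L then (1 : ℝ) - q i else 1)) = ∏_{i<k} (1 - q i · 1{i ∈ L})` — given `L`, no open coin among `0..k-1` lands in `L`;
* `(Finset.prod (Finset.range k) (fun i => (1 : ℝ) - q i)) = ∏_{i<k} (1 - q i)` — no coin among `0..k-1` is open;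
* `((q j) * Finset.prod (Finset.Ico (j + 1) k) (fun i => (1 : ℝ) - q i)) = q j ∏_{j<i<k} (1 - q i)` — hit weight of unit `j` among `k` units (priority to larger indices);
* `(Finset.sum s (fun ω => p ω * ((Finset.prod (Finset.range k) (fun i => if i ∈ (L ω) then (1 : ℝ) - q i else 1)) - (Finset.prod (Finset.range k) (fun i => (1 : ℝ) - q i))))) = Σ_ω p ω (slPi - slAll)` — bad mass (some coin open, no open coin alive);
* `(Finset.sum s (fun ω => p ω * (if j ∈ L ω then (0 : ℝ) else 1 - (q j) * (1 - (Finset.prod (Finset.range k) (fun i => if i ∈ (L ω) then (1 : ℝ) - q i else 1)))))) = Σ_ω p ω 1{j ∉ L ω}(1 - q j (1 - slPi))` — unreliability of unit `j` (dead and not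
  rescued through the centre: rescue needs the own coin open and some other open coin alive);
* `(Finset.sum s (fun ω => p ω * (if j ∈ L ω then (0 : ℝ) else 1))) = Σ_ω p ω 1{j ∉ L ω}` — deadness of unit `j`.
-/

/-- `0 ≤ slPi`. -/
theorem slPi_nonneg (q : ℕ → ℝ) (hq0 : ∀ j, 0 ≤ q j) (hq1 : ∀ j, q j ≤ 1) (L : Finset ℕ) (k : ℕ) :
    0 ≤ (Finset.prod (Finset.range k) (fun i => if i ∈ L then (1 : ℝ) - q i else 1)) := by
  have _ := hq0
  refine Finset.prod_nonneg fun i _ => ?_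
  split_ifs
  · linarith [hq1 i]
  · exact zero_le_one

/-- `slPi ≤ 1`. -/
theorem slPi_le_one (q : ℕ → ℝ) (hq0 : ∀ j, 0 ≤ q j) (hq1 : ∀ j, q j ≤ 1) (L : Finset ℕ) (k : ℕ) :
    (Finset.prod (Finset.range k) (fun i => if i ∈ L then (1 : ℝ) - q i else 1)) ≤ 1 := by
  refine Finset.prod_le_one (fun i _ => ?_) (fun i _ => ?_)
  · split_ifs
    · linarith [hq1 i]
    · exact zero_le_one
  · split_ifs
    · linarith [hq0 i]
    · exact le_rfl

/-- `0 ≤ slW`. -/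
theorem slW_nonneg (q : ℕ → ℝ) (hq0 : ∀ j, 0 ≤ q j) (hq1 : ∀ j, q j ≤ 1) (k j : ℕ) :
    0 ≤ ((q j) * Finset.prod (Finset.Ico (j + 1) k) (fun i => (1 : ℝ) - q i)) := by
  refine mul_nonneg (hq0 j) (Finset.prod_nonneg fun i _ => ?_)
  linarith [hq1 i]

/-- Recursion for `slPi`. -/
theorem slPi_succ (q : ℕ → ℝ) (L : Finset ℕ) (k : ℕ) :
    (Finset.prod (Finset.range (k + 1)) (fun i => if i ∈ L then (1 : ℝ) - q i else 1)) = (Finset.prod (Finset.range k) (fun i => if i ∈ L then (1 : ℝ) - q i else 1)) * (if k ∈ L then 1 - q k else 1) := by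
  rw [Finset.prod_range_succ]

/-- Recursion for `slAll`. -/
theorem slAll_succ (q : ℕ → ℝ) (k : ℕ) : (Finset.prod (Finset.range (k + 1)) (fun i => (1 : ℝ) - q i)) = (Finset.prod (Finset.range k) (fun i => (1 : ℝ) - q i)) * (1 - q k) := by
  rw [Finset.prod_range_succ]

/-- Recursion for `slW` below the top. -/
theorem slW_succ_of_lt (q : ℕ → ℝ) {k j : ℕ} (hj : j < k) :
    ((q j) * Finset.prod (Finset.Ico (j + 1) (k + 1)) (fun i => (1 : ℝ) - q i)) = ((q j) * Finset.prod (Finset.Ico (j + 1) k) (fun i => (1 : ℝ) - q i)) * (1 - q k) := by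
  rw [Finset.prod_Ico_succ_top (Nat.succ_le_of_lt hj)]
  ring

/-- The top hit weight. -/
theorem slW_succ_self (q : ℕ → ℝ) (k : ℕ) : ((q k) * Finset.prod (Finset.Ico (k + 1) (k + 1)) (fun i => (1 : ℝ) - q i)) = q k := by
  rw [Finset.Ico_self, Finset.prod_empty, mul_one]

/-- **Telescoping bound.** `Σ_{j<k, j ∈ L} ((q j) * Finset.prod (Finset.Ico (j + 1) k) (fun i => (1 : ℝ) - q i)) ≤ 1 - (Finset.prod (Finset.range k) (fun i => if i ∈ L then (1 : ℝ) - q i else 1))`. -/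
theorem starLemma_sum_filter_slW_le (q : ℕ → ℝ) (hq0 : ∀ j, 0 ≤ q j) (hq1 : ∀ j, q j ≤ 1)
    (L : Finset ℕ) (k : ℕ) :
    ∑ j ∈ (range k).filter (fun j => j ∈ L), ((q j) * Finset.prod (Finset.Ico (j + 1) k) (fun i => (1 : ℝ) - q i)) ≤ 1 - (Finset.prod (Finset.range k) (fun i => if i ∈ L then (1 : ℝ) - q i else 1)) := by
  induction k with
  | zero => simp
  | succ k ih =>
    have hPi0 := slPi_nonneg q hq0 hq1 L k
    have hPi1 := slPi_le_one q hq0 hq1 L k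
    have hnot : k ∉ (range k).filter (fun j => j ∈ L) := by simp
    have h1 : 0 ≤ 1 - q k := by linarith [hq1 k]
    have hs : 0 ≤ ∑ j ∈ (range k).filter (fun j => j ∈ L), ((q j) * Finset.prod (Finset.Ico (j + 1) k) (fun i => (1 : ℝ) - q i)) :=
      Finset.sum_nonneg fun j _ => slW_nonneg q hq0 hq1 k j
    -- the sum over the old indices, rescaled
    have hold : ∑ j ∈ (range k).filter (fun j => j ∈ L), ((q j) * Finset.prod (Finset.Ico (j + 1) (k + 1)) (fun i => (1 : ℝ) - q i))
        = (∑ j ∈ (range k).filter (fun j => j ∈ L), ((q j) * Finset.prod (Finset.Ico (j + 1) k) (fun i => (1 : ℝ) - q i))) * (1 - q k) := by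
      rw [Finset.sum_mul]
      refine Finset.sum_congr rfl fun j hj => ?_
      have hjk : j < k := Finset.mem_range.1 (Finset.mem_filter.1 hj).1
      exact slW_succ_of_lt q hjk
    have hih := mul_le_mul_of_nonneg_right ih h1
    rw [slPi_succ, Finset.range_add_one, Finset.filter_insert]
    by_cases hk : k ∈ L
    · rw [if_pos hk, if_pos hk, Finset.sum_insert hnot, slW_succ_self, hold]
      nlinarith [hih, hq0 k]
    · rw [if_neg hk, if_neg hk, hold, mul_one]
      nlinarith [hih, hq0 k]

/-- Recursion for the bad mass: peel the top (deadest) unit. -/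
theorem slBad_succ (s : Finset Ω) (p : Ω → ℝ) (L : Ω → Finset ℕ) (q : ℕ → ℝ) (k : ℕ) :
    (Finset.sum s (fun ω => p ω * ((Finset.prod (Finset.range ((k + 1))) (fun i => if i ∈ (L ω) then (1 : ℝ) - q i else 1)) - (Finset.prod (Finset.range ((k + 1))) (fun i => (1 : ℝ) - q i))))) = (1 - q k) * (Finset.sum s (fun ω => p ω * ((Finset.prod (Finset.range k) (fun i => if i ∈ (L ω) then (1 : ℝ) - q i else 1)) - (Finset.prod (Finset.range k) (fun i => (1 : ℝ) - q i)))))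
      + q k * ∑ ω ∈ s, p ω * (if k ∈ L ω then 0 else (Finset.prod (Finset.range k) (fun i => if i ∈ (L ω) then (1 : ℝ) - q i else 1))) := by
  rw [Finset.mul_sum, Finset.mul_sum, ← Finset.sum_add_distrib]
  refine Finset.sum_congr rfl fun ω _ => ?_
  rw [slPi_succ, slAll_succ]
  split_ifs <;> ring

/-- Recursion for the unreliability of a lower unit. -/
theorem slR_succ_of_lt (s : Finset Ω) (p : Ω → ℝ) (L : Ω → Finset ℕ) (q : ℕ → ℝ) {k j : ℕ}
    (hj : j < k) :
    (Finset.sum s (fun ω => p ω * (if j ∈ L ω then (0 : ℝ) else 1 - (q j) * (1 - (Finset.prod (Finset.range ((k + 1))) (fun i => if i ∈ (L ω) then (1 : ℝ) - q i else 1)))))) = (Finset.sum s (fun ω => p ω * (if j ∈ L ω then (0 : ℝ) else 1 - (q j) * (1 - (Finset.prod (Finset.range k) (fun i => if i ∈ (L ω) then (1 : ℝ) - q i else 1))))))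
      - q j * q k * ∑ ω ∈ s, p ω * (if j ∈ L ω then 0 else if k ∈ L ω then (Finset.prod (Finset.range k) (fun i => if i ∈ (L ω) then (1 : ℝ) - q i else 1)) else 0) := by
  have _ := hj
  rw [Finset.mul_sum, ← Finset.sum_sub_distrib]
  refine Finset.sum_congr rfl fun ω _ => ?_
  rw [slPi_succ]
  split_ifs <;> ring

/-- The unreliability of the top unit in the enlarged system. -/
theorem slR_succ_self (s : Finset Ω) (p : Ω → ℝ) (L : Ω → Finset ℕ) (q : ℕ → ℝ) (k : ℕ) :
    (Finset.sum s (fun ω => p ω * (if k ∈ L ω then (0 : ℝ) else 1 - (q k) * (1 - (Finset.prod (Finset.range ((k + 1))) (fun i => if i ∈ (L ω) then (1 : ℝ) - q i else 1)))))) = ∑ ω ∈ s, p ω * (if k ∈ L ω then 0 else 1 - q k * (1 - (Finset.prod (Finset.range k) (fun i => if i ∈ (L ω) then (1 : ℝ) - q i else 1)))) := by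
  refine Finset.sum_congr rfl fun ω _ => ?_
  rw [slPi_succ]
  split_ifs <;> ring

/-- The exchange inequality: if unit `k` is at least as dead as unit `j` then
`P(j ∉ L, k ∈ L) ≤ P(k ∉ L, j ∈ L)`. -/
theorem starLemma_exchange (s : Finset Ω) (p : Ω → ℝ) (L : Ω → Finset ℕ) {j k : ℕ}
    (h : (Finset.sum s (fun ω => p ω * (if j ∈ L ω then (0 : ℝ) else 1))) ≤ (Finset.sum s (fun ω => p ω * (if k ∈ L ω then (0 : ℝ) else 1)))) :
    ∑ ω ∈ s, p ω * (if j ∈ L ω then 0 else if k ∈ L ω then 1 else 0)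
      ≤ ∑ ω ∈ s, p ω * (if k ∈ L ω then 0 else if j ∈ L ω then 1 else 0) := by
  have hj : ∑ ω ∈ s, p ω * (if j ∈ L ω then 0 else if k ∈ L ω then 1 else 0)
      = ∑ ω ∈ s, p ω * (if j ∈ L ω then 0 else 1)
        - ∑ ω ∈ s, p ω * (if j ∈ L ω then 0 else if k ∈ L ω then 0 else 1) := by
    rw [← Finset.sum_sub_distrib]
    refine Finset.sum_congr rfl fun ω _ => ?_
    split_ifs <;> ring
  have hk : ∑ ω ∈ s, p ω * (if k ∈ L ω then 0 else if j ∈ L ω then 1 else 0)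
      = ∑ ω ∈ s, p ω * (if k ∈ L ω then 0 else 1)
        - ∑ ω ∈ s, p ω * (if j ∈ L ω then 0 else if k ∈ L ω then 0 else 1) := by
    rw [← Finset.sum_sub_distrib]
    refine Finset.sum_congr rfl fun ω _ => ?_
    split_ifs <;> ring
  rw [hj, hk]
  linarith

/-- **The Star Lemma (law level).**  If deadness is non-decreasing along `0, …, k-1`, the bad mass is at
most the hit-weighted sum of the unreliabilities (priority to larger, deader indices). -/
theorem starLemma' (s : Finset Ω) (p : Ω → ℝ) (hp : ∀ ω ∈ s, 0 ≤ p ω) (L : Ω → Finset ℕ)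
    (q : ℕ → ℝ) (hq0 : ∀ j, 0 ≤ q j) (hq1 : ∀ j, q j ≤ 1) (k : ℕ)
    (hmono : ∀ i j, i ≤ j → j < k → (Finset.sum s (fun ω => p ω * (if i ∈ L ω then (0 : ℝ) else 1))) ≤ (Finset.sum s (fun ω => p ω * (if j ∈ L ω then (0 : ℝ) else 1)))) :
    (Finset.sum s (fun ω => p ω * ((Finset.prod (Finset.range k) (fun i => if i ∈ (L ω) then (1 : ℝ) - q i else 1)) - (Finset.prod (Finset.range k) (fun i => (1 : ℝ) - q i))))) ≤ ∑ j ∈ range k, ((q j) * Finset.prod (Finset.Ico (j + 1) k) (fun i => (1 : ℝ) - q i)) * (Finset.sum s (fun ω => p ω * (if j ∈ L ω then (0 : ℝ) else 1 - (q j) * (1 - (Finset.prod (Finset.range k) (fun i => if i ∈ (L ω) then (1 : ℝ) - q i else 1)))))) := by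
  induction k with
  | zero =>
    simp
  | succ k ih =>
    have hmono' : ∀ i j, i ≤ j → j < k → (Finset.sum s (fun ω => p ω * (if i ∈ L ω then (0 : ℝ) else 1))) ≤ (Finset.sum s (fun ω => p ω * (if j ∈ L ω then (0 : ℝ) else 1))) :=
      fun i j hij hjk => hmono i j hij (Nat.lt_succ_of_lt hjk)
    have IH := ih hmono'
    have hqk0 := hq0 k
    have hqk1 : 0 ≤ 1 - q k := by linarith [hq1 k]
    -- abbreviations
    set E : ℕ → ℝ := fun j =>
      ∑ ω ∈ s, p ω * (if j ∈ L ω then 0 else if k ∈ L ω then (Finset.prod (Finset.range k) (fun i => if i ∈ (L ω) then (1 : ℝ) - q i else 1)) else 0) with hE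
    set M : ℝ := ∑ ω ∈ s, p ω * (if k ∈ L ω then 0 else (1 - (Finset.prod (Finset.range k) (fun i => if i ∈ (L ω) then (1 : ℝ) - q i else 1)))) with hM
    set P0 : ℝ := ∑ ω ∈ s, p ω * (if k ∈ L ω then 0 else (Finset.prod (Finset.range k) (fun i => if i ∈ (L ω) then (1 : ℝ) - q i else 1))) with hP0
    -- rewrite the right-hand side of the goal
    have hRHS : ∑ j ∈ range (k + 1), ((q j) * Finset.prod (Finset.Ico (j + 1) (k + 1)) (fun i => (1 : ℝ) - q i)) * (Finset.sum s (fun ω => p ω * (if j ∈ L ω then (0 : ℝ) else 1 - (q j) * (1 - (Finset.prod (Finset.range ((k + 1))) (fun i => if i ∈ (L ω) then (1 : ℝ) - q i else 1))))))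
        = (1 - q k) * ∑ j ∈ range k, ((q j) * Finset.prod (Finset.Ico (j + 1) k) (fun i => (1 : ℝ) - q i)) * (Finset.sum s (fun ω => p ω * (if j ∈ L ω then (0 : ℝ) else 1 - (q j) * (1 - (Finset.prod (Finset.range k) (fun i => if i ∈ (L ω) then (1 : ℝ) - q i else 1))))))
          - (1 - q k) * q k * ∑ j ∈ range k, ((q j) * Finset.prod (Finset.Ico (j + 1) k) (fun i => (1 : ℝ) - q i)) * q j * E j
          + q k * (Finset.sum s (fun ω => p ω * (if k ∈ L ω then (0 : ℝ) else 1 - (q k) * (1 - (Finset.prod (Finset.range ((k + 1))) (fun i => if i ∈ (L ω) then (1 : ℝ) - q i else 1)))))) := by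
      rw [Finset.sum_range_succ, slW_succ_self, Finset.mul_sum (s := range k) (a := 1 - q k),
        Finset.mul_sum (s := range k) (a := (1 - q k) * q k), ← Finset.sum_sub_distrib]
      congr 1
      refine Finset.sum_congr rfl fun j hj => ?_
      have hjk : j < k := Finset.mem_range.1 hj
      rw [slW_succ_of_lt q hjk, slR_succ_of_lt s p L q hjk]
      simp only [hE]
      ring
    have hRk : (Finset.sum s (fun ω => p ω * (if k ∈ L ω then (0 : ℝ) else 1 - (q k) * (1 - (Finset.prod (Finset.range ((k + 1))) (fun i => if i ∈ (L ω) then (1 : ℝ) - q i else 1)))))) = (1 - q k) * (Finset.sum s (fun ω => p ω * (if k ∈ L ω then (0 : ℝ) else 1))) + q k * P0 := by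
      rw [slR_succ_self, hP0]
      rw [Finset.mul_sum, Finset.mul_sum, ← Finset.sum_add_distrib]
      refine Finset.sum_congr rfl fun ω _ => ?_
      split_ifs <;> ring
    have hDk : (Finset.sum s (fun ω => p ω * (if k ∈ L ω then (0 : ℝ) else 1))) = M + P0 := by
      rw [hM, hP0]
      rw [← Finset.sum_add_distrib]
      refine Finset.sum_congr rfl fun ω _ => ?_
      split_ifs <;> ring
    -- the key estimate (★'): Σ_j slW_j q_j E_j ≤ M
    have hkey : ∑ j ∈ range k, ((q j) * Finset.prod (Finset.Ico (j + 1) k) (fun i => (1 : ℝ) - q i)) * q j * E j ≤ M := by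
      -- step 1: E j ≤ P(k ∉ L, j ∈ L)
      have hE1 : ∀ j ∈ range k, E j ≤ ∑ ω ∈ s, p ω * (if k ∈ L ω then 0 else if j ∈ L ω then 1 else 0) := by
        intro j hj
        have hjk : j < k := Finset.mem_range.1 hj
        have h1 : E j ≤ ∑ ω ∈ s, p ω * (if j ∈ L ω then 0 else if k ∈ L ω then 1 else 0) := by
          simp only [hE]
          refine Finset.sum_le_sum fun ω hω => mul_le_mul_of_nonneg_left ?_ (hp ω hω)
          split_ifs
          · exact le_rfl
          · exact slPi_le_one q hq0 hq1 _ _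
          · exact le_rfl
        exact h1.trans (starLemma_exchange s p L (hmono j k hjk.le (Nat.lt_succ_self k)))
      -- step 2: sum with weights slW_j q_j ≤ slW_j
      calc ∑ j ∈ range k, ((q j) * Finset.prod (Finset.Ico (j + 1) k) (fun i => (1 : ℝ) - q i)) * q j * E j
          ≤ ∑ j ∈ range k, ((q j) * Finset.prod (Finset.Ico (j + 1) k) (fun i => (1 : ℝ) - q i)) *
              ∑ ω ∈ s, p ω * (if k ∈ L ω then 0 else if j ∈ L ω then 1 else 0) := by
            refine Finset.sum_le_sum fun j hj => ?_
            have hw := slW_nonneg q hq0 hq1 k j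
            have hEj : 0 ≤ E j := by
              simp only [hE]
              refine Finset.sum_nonneg fun ω hω => mul_nonneg (hp ω hω) ?_
              split_ifs
              · exact le_rfl
              · exact slPi_nonneg q hq0 hq1 _ _
              · exact le_rfl
            calc ((q j) * Finset.prod (Finset.Ico (j + 1) k) (fun i => (1 : ℝ) - q i)) * q j * E j ≤ ((q j) * Finset.prod (Finset.Ico (j + 1) k) (fun i => (1 : ℝ) - q i)) * 1 * E j := by
                  refine mul_le_mul_of_nonneg_right (mul_le_mul_of_nonneg_left (hq1 j) hw) hEj
              _ = ((q j) * Finset.prod (Finset.Ico (j + 1) k) (fun i => (1 : ℝ) - q i)) * E j := by ring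
              _ ≤ _ := mul_le_mul_of_nonneg_left (hE1 j hj) hw
        _ = ∑ ω ∈ s, p ω * ((if k ∈ L ω then 0 else 1) *
              ∑ j ∈ (range k).filter (fun j => j ∈ L ω), ((q j) * Finset.prod (Finset.Ico (j + 1) k) (fun i => (1 : ℝ) - q i))) := by
            have hswap : ∑ j ∈ range k, ((q j) * Finset.prod (Finset.Ico (j + 1) k) (fun i => (1 : ℝ) - q i)) *
                ∑ ω ∈ s, p ω * (if k ∈ L ω then 0 else if j ∈ L ω then 1 else 0)
                = ∑ j ∈ range k, ∑ ω ∈ s,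
                    ((q j) * Finset.prod (Finset.Ico (j + 1) k) (fun i => (1 : ℝ) - q i)) * (p ω * (if k ∈ L ω then 0 else if j ∈ L ω then 1 else 0)) := by
              refine Finset.sum_congr rfl fun j _ => ?_
              rw [Finset.mul_sum]
            rw [hswap, Finset.sum_comm]
            refine Finset.sum_congr rfl fun ω _ => ?_
            rw [Finset.sum_filter, Finset.mul_sum, Finset.mul_sum]
            refine Finset.sum_congr rfl fun j _ => ?_
            split_ifs <;> ring
        _ ≤ M := by
            simp only [hM]
            refine Finset.sum_le_sum fun ω hω => mul_le_mul_of_nonneg_left ?_ (hp ω hω)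
            split_ifs
            · simp
            · rw [one_mul]
              exact starLemma_sum_filter_slW_le q hq0 hq1 (L ω) k
    -- assemble
    rw [slBad_succ, hRHS, hRk, hDk]
    have hIH' : (1 - q k) * (Finset.sum s (fun ω => p ω * ((Finset.prod (Finset.range k) (fun i => if i ∈ (L ω) then (1 : ℝ) - q i else 1)) - (Finset.prod (Finset.range k) (fun i => (1 : ℝ) - q i))))) ≤ (1 - q k) * ∑ j ∈ range k, ((q j) * Finset.prod (Finset.Ico (j + 1) k) (fun i => (1 : ℝ) - q i)) * (Finset.sum s (fun ω => p ω * (if j ∈ L ω then (0 : ℝ) else 1 - (q j) * (1 - (Finset.prod (Finset.range k) (fun i => if i ∈ (L ω) then (1 : ℝ) - q i else 1)))))) :=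
      mul_le_mul_of_nonneg_left IH hqk1
    rw [← hP0]
    nlinarith [mul_le_mul_of_nonneg_left (mul_le_mul_of_nonneg_left hkey hqk0) hqk1, hIH']

/-- **The Star Lemma (law level), registered form** (stub `starLemma` of stmt-CriticalPhenomena-4575): the
statement of `starLemma'` with all binders after the colon. -/
theorem starLemma : ∀ {Ω : Type*} (s : Finset Ω) (p : Ω → ℝ), (∀ ω ∈ s, 0 ≤ p ω) → ∀ (L : Ω → Finset ℕ) (q : ℕ → ℝ), (∀ j, 0 ≤ q j) → (∀ j, q j ≤ 1) → ∀ (k : ℕ), (∀ i j, i ≤ j → j < k → (Finset.sum s (fun ω => p ω * (if i ∈ L ω then (0 : ℝ) else 1))) ≤ (Finset.sum s (fun ω => p ω * (if j ∈ L ω then (0 : ℝ) else 1)))) → (Finset.sum s (fun ω => p ω * ((Finset.prod (Finset.range k) (fun i => if i ∈ (L ω) then (1 : ℝ) - q i else 1)) - (Finset.prod (Finset.range k) (fun i => (1 : ℝ) - q i))))) ≤ ∑ j ∈ Finset.range k, ((q j) * Finset.prod (Finset.Ico (j + 1) k) (fun i => (1 : ℝ) - q i)) * (Finset.sum s (fun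 ω => p ω * (if j ∈ L ω then (0 : ℝ) else 1 - (q j) * (1 - (Finset.prod (Finset.range k) (fun i => if i ∈ (L ω) then (1 : ℝ) - q i else 1)))))) :=
  fun s p hp L q hq0 hq1 k hmono => starLemma' s p hp L q hq0 hq1 k hmono

end Summit.CriticalPhenomena.PercolationContinuityZ3.Theorems
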